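import Mathlib
import Summits.KontsevichZagierPeriods.Zeta5Search.Families.CubicalChartVIM
import Summits.KontsevichZagierPeriods.Zeta5Search.Families.GaussCongruence
import HarnessLib

/-!
# ζ(5) search — Families: Gauss congruences for the VIM leading coefficients `A n` (all primes, unconditional)

HONEST FRAMING: systematic search; no irrationality claim unless certified.  Cell `pub-zeta5`, seat P2 g10 (Families
layer), 2026-08-23.  Congruences between integers; nothing about the arithmetic of `ζ(5)` or `ζ(7)`; no record moves;
no conjecture node is used or discharged.  The mathematics is classical (constant terms of powers of an integral
Laurent polynomial satisfy the Gauss congruences, [cite: BeukersHoubenStraub2018, §1]; kernel form = fam-tele g13's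
`GaussCT.gauss_of_eq_coeff_smul_pow`, `Families/GaussCongruence`); NEW here is only its APPLICATION to Brown's
`vanishing in the middle' plan, which `Families/GaussCongruence` explicitly left unclaimed ("D-exact(VIM) is NOT in the
tree beyond `n = 1`") and which cert-2 g10's frame-gauge identity `CubicalChartN.A_eq_vimDualCT` (D-exact(VIM) on the
whole diagonal, `Families/CubicalChartVIM`) now permits:
* `vimSpanProd_basic`: the diagonal span product is the `n`-th power of the `n = 1` one;
* `A_eq_coeff_pow`: `A n = [g^{n·𝟙}] (vimSpanProd 𝟙)ⁿ`;
* **`A_gauss`**: `pʳ ∣ A(m pʳ) − A(m pʳ⁻¹)` for EVERY prime `p` and all `m, r` — the all-primes `mod pʳ` floor under the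
  tree's conjecture node `CellularVIMRecurrenceLaws.VIMSupercongruence` (= the VIM instance of
  [MccarthyOsburnStraub2018, Conjecture 1.3], which asks `mod p^{3r}` for `p ≥ 5` and is NOT claimed);
* `A_prime_sub_61`: `A p ≡ 61 (mod p)` for every prime `p`;
* `leading_ray_gauss`: the same congruences along EVERY balanced ray `n ↦ leading (n•a) (n•b)` of the generalised family
  (cert-2 g10's `leading_eq_vimDualCT` for all balanced pairs).
Standard axioms only.
-/

noncomputable section

open MvPolynomial Finset

namespace Summit.KontsevichZagierPeriods.Zeta5Search.Families.Cellular

namespace VIMGauss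

open Summit.KontsevichZagierPeriods.Zeta5Search.Families.CellularVIMRecurrenceLaws (A A_one)

/-- On the diagonal the frame-gauge span product is a pure power: `vimSpanProd (n,…,n) = (vimSpanProd (1,…,1))ⁿ`. -/
theorem vimSpanProd_basic (n : ℕ) :
    CubicalChartN.vimSpanProd (Cells.VanishingMiddleLeading.basic n) =
      CubicalChartN.vimSpanProd (Cells.VanishingMiddleLeading.basic 1) ^ n := by
  simp only [CubicalChartN.vimSpanProd, Cells.VanishingMiddleLeading.basic, pow_one, mul_pow]

/-- On the diagonal the gap exponent vector is `n • (1,…,1)`. -/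
theorem vimGap_basic (n : ℕ) :
    Finsupp.equivFunOnFinite.symm (CubicalChartN.vimGap (Cells.VanishingMiddleLeading.basic n)) =
      n • Finsupp.equivFunOnFinite.symm (CubicalChartN.vimGap (Cells.VanishingMiddleLeading.basic 1)) := by
  ext t
  fin_cases t <;> simp [CubicalChartN.vimGap, Cells.VanishingMiddleLeading.basic]

/-- **`A n` is a coefficient sequence of powers of ONE integral polynomial:** `A n = [g^{n·𝟙}] (vimSpanProd 𝟙)ⁿ`
(cert-2 g10's `CubicalChartN.A_eq_vimDualCT` rewritten). -/
theorem A_eq_coeff_pow (n : ℕ) :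
    A n = coeff (n • Finsupp.equivFunOnFinite.symm (CubicalChartN.vimGap (Cells.VanishingMiddleLeading.basic 1)))
      (CubicalChartN.vimSpanProd (Cells.VanishingMiddleLeading.basic 1) ^ n) := by
  rw [CubicalChartN.A_eq_vimDualCT, CubicalChartN.vimDualCT, vimGap_basic, vimSpanProd_basic]

/-- **Gauss congruences for the VIM leading coefficients (UNCONDITIONAL, every prime):** `pʳ ∣ A(m pʳ) − A(m pʳ⁻¹)`
for every prime `p` and all `m r : ℕ` (`A n` = the leading, `ζ(7)`-, coefficient of the `n`-th form of Brown's
`vanishing in the middle' family, [BrownZudilin2022, §12]; `1, 61, 52921, 94357501, …`).  This is the `mod pʳ` floor under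
`CellularVIMRecurrenceLaws.VIMSupercongruence` (`mod p^{3r}`, `p ≥ 5`, [MccarthyOsburnStraub2018, Conjecture 1.3]) — the
supercongruence itself is NOT claimed. -/
theorem A_gauss {p : ℕ} (hp : p.Prime) (m r : ℕ) : ((p : ℤ) ^ r) ∣ A (m * p ^ r) - A (m * p ^ (r - 1)) :=
  GaussCT.gauss_of_eq_coeff_smul_pow A _ _ A_eq_coeff_pow hp m r

/-- `A p ≡ 61 (mod p)` for every prime `p` (`A 1 = 61`). -/
theorem A_prime_sub_61 {p : ℕ} (hp : p.Prime) : (p : ℤ) ∣ A p - 61 := by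
  have h := A_gauss hp 1 1
  rw [pow_one, pow_one, one_mul, Nat.sub_self, pow_zero, mul_one, A_one] at h
  exact h

/-- Kernel instance beyond the Gauss floor, at the supercongruence exponent: `7³ ∣ A 7 − A 1` is NOT decided here (no
value of `A 7` in the tree); the decided instance `5³ ∣ A 5 − A 1` is `CellularVIMRecurrenceLaws.supercongruence_5_1_1`.
What the floor gives at `p = 5`: `5 ∣ A 5 − 61`. -/
theorem A_five_sub_61 : (5 : ℤ) ∣ A 5 - 61 := by
  have := A_prime_sub_61 (p := 5) (by norm_num)
  simpa using this

/-! ## Along every ray of the generalised VIM family -/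

/-- Balance is preserved along rays: `Balanced (n•a) (n•b)`. -/
theorem balanced_smul (a b : Fin 10 → ℕ) (h : Cells.VanishingMiddleLeading.Balanced a b) (n : ℕ) :
    Cells.VanishingMiddleLeading.Balanced (fun i => n * a i) (fun i => n * b i) := by
  obtain ⟨h1, h2, h3, h4, h5, h6, h7, h8, h9, h10⟩ := h
  refine ⟨?_, ?_, ?_, ?_, ?_, ?_, ?_, ?_, ?_, ?_⟩ <;> simp only [← mul_add] <;> congr 1

/-- Along a ray the frame-gauge span product is a pure power. -/
theorem vimSpanProd_smul (a : Fin 10 → ℕ) (n : ℕ) :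
    CubicalChartN.vimSpanProd (fun i => n * a i) = CubicalChartN.vimSpanProd a ^ n := by
  simp only [CubicalChartN.vimSpanProd, mul_pow, ← pow_mul, mul_comm n]

/-- Along a ray the gap exponent vector is `n •` the base one. -/
theorem vimGap_smul (b : Fin 10 → ℕ) (n : ℕ) :
    Finsupp.equivFunOnFinite.symm (CubicalChartN.vimGap fun i => n * b i) =
      n • Finsupp.equivFunOnFinite.symm (CubicalChartN.vimGap b) := by
  ext t
  fin_cases t <;> simp [CubicalChartN.vimGap]

/-- **Gauss congruences along every balanced ray of the generalised VIM family (UNCONDITIONAL, every prime):** for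
balanced `(a, b)` the census leading coefficients `u n = leading (n•a) (n•b)` (fam-brown9, `Cells/VanishingMiddleLeading`)
satisfy `pʳ ∣ u(m pʳ) − u(m pʳ⁻¹)` — by cert-2 g10's `leading_eq_vimDualCT` (every balanced pair) and the generic lemma. -/
theorem leading_ray_gauss (a b : Fin 10 → ℕ) (hbal : Cells.VanishingMiddleLeading.Balanced a b) {p : ℕ} (hp : p.Prime)
    (m r : ℕ) :
    ((p : ℤ) ^ r) ∣ Cells.VanishingMiddleLeading.leading (fun i => (m * p ^ r) * a i) (fun i => (m * p ^ r) * b i) -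
      Cells.VanishingMiddleLeading.leading (fun i => (m * p ^ (r - 1)) * a i) (fun i => (m * p ^ (r - 1)) * b i) := by
  have hu : ∀ n : ℕ, Cells.VanishingMiddleLeading.leading (fun i => n * a i) (fun i => n * b i) =
      coeff (n • Finsupp.equivFunOnFinite.symm (CubicalChartN.vimGap b)) (CubicalChartN.vimSpanProd a ^ n) := by
    intro n
    rw [CubicalChartN.leading_eq_vimDualCT _ _ (balanced_smul a b hbal n), CubicalChartN.vimDualCT, vimGap_smul,
      vimSpanProd_smul]
  exact GaussCT.gauss_of_eq_coeff_smul_pow (fun n => Cells.VanishingMiddleLeading.leading (fun i => n * a i) (fun i => n * b i))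
    _ _ hu hp m r

end VIMGauss

end Summit.KontsevichZagierPeriods.Zeta5Search.Families.Cellular
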